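import Summits.Ventures.YMGap.RobustBall.StarDoorZdW
import Summits.Ventures.YMGap.Thresholds.StarInfiniteVolume
import Summits.Ventures.YMGap.Thresholds.StarLemmaGRows
import HarnessLib

/-!
# Venture YMGap, track ROBUST-BALL — ONE STATE AT A RATE THROUGH THE `ℤ^d` VERTEX-STAR DOORS: a finite volume forgets its
# boundary field at the star rate, and `SU(2)` lattice Yang–Mills on `ℤ⁴` at EVERY `0 ≤ β_W ≤ 9/25`

HONEST FRAMING. WHAT THIS IS: a venture file (cell `pub-ymgap`, track Y2 ROBUST-BALL, seat ds-3, theorems only): the STAR-WINDOW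
twin of the seat's single-link boundary-decay series (`BoundaryDecay*.lean`: `SU(2)`, `d = 4` up to `β_W ≤ 1/12`, `< 1/6`, `≤ 2/9` through
the KR door). The Literature's boundary-insensitivity theorem for the window kernels
(`DobrushinShlosman.abs_integral_sub_integral_le_of_window`, Dobrushin–Shlosman 1985 Thm. 1 in the Vasserstein form, run on the
finite volume itself) is fed with the `ℤ^d` star arrays of ds-1 / ds-2 and a DEPTH PROFILE of the volume:
* `exists_starDepthProfile` — for a finite link volume `Λ₀`, a `1`-Lipschitz (sup-norm of base points) depth function `φ` with
  `φ > 0 ⇒ ∈ Λ₀`, and locality radius `D`: `ℓ x = ⌊φ x/(D+2)⌋` has every star through a link of positive profile with centre and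
  locality set INSIDE `Λ₀`, drops by at most one along the array, and is `≥ ⌊m/(D+2)⌋` where `φ ≥ m`;
* ★★ `abs_kernel_sub_kernel_le_of_starArray` — DOOR LEVEL (any specification on the links of `ℤ^d` with `SU(N)` spins, quasilocal star
  kernels of radius `D`, star array with per-star received sum `≤ ρ < 1`, sitewise (H1), Frobenius weight): for every finite `Λ₀`,
  ANY TWO boundary fields `ω, η`, and a bounded measurable `F` on links `Δ ⊆ Λ₀` with `φ ≥ m` on `Δ` and Frobenius-Lipschitz vector `δ`:
  `|∫F dγ_{Λ₀}(·|ω) − ∫F dγ_{Λ₀}(·|η)| ≤ 2(2√N) e^{−κ₁⌊m/(D+2)⌋} Σ_{Δ} δ`, `κ₁ = starRate d ρ`;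
  `abs_kernel_sub_integral_le_of_starArray` — against EVERY Gibbs measure `μ` (DLR: `μ F = ∫ γ_{Λ₀}(F|ω) dμ(ω)`), same bound;
* `abs_kernel_sub_integral_le_of_starWindowBoundZd` — ds-1's Wilson door (`StarWindowBoundZd`, radius `2`);
* ★★★ `su2_wilson_boundary_star` — `SU(2)`, `d = 4`, Wilson action, EVERY `0 ≤ β_W ≤ 9/25`, HYPOTHESIS-FREE (Lemma G + the torus → `ℤ⁴`
  transfer, as in `StarInfiniteVolume`): for every finite `Λ₀`, EVERY boundary field `η`, EVERY DLR state `μ`, every depth function `φ` of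
  `Λ₀` and every Lipschitz cylinder `F` (links `Δ ⊆ Λ₀` with `φ ≥ m` on `Δ`, constant `K`):
  `|∫F dγ_{Λ₀}(·|η) − ∫F dμ| ≤ 4√2 · K · #Δ · exp(−starRate 4 (R_G β_W) · ⌊m/4⌋)`;
  `su2_wilson_box_star` (boxes: `Δ` based in `box 4 M'`, volume the links based in
  `box 4 M`, rate `exp(−κ₁⌊(M + 1 − M')/4⌋)` — the thermodynamic limit along boxes UNIFORMLY IN THE BOUNDARY FIELD on the whole window).
WHAT THIS IS NOT: strong-coupling LATTICE statements; the rate is the Dobrushin–Shlosman window rate `κ₁ = (1−ρ)²/(2(16ρ+1))`, an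
artefact of the door (`R_G(β_W) < 1` iff `β_W < 0.3609…`); nothing about the continuum limit or the Clay Millennium problem.

References: R. L. Dobrushin, S. B. Shlosman (1985), Thm. 1; H. Föllmer, LNM 1362 (1988) Ch. I (2.7)–(2.10); H.-O. Georgii (2011)
Thm. 8.20, Remark 1.24; the Literature's `DobrushinShlosmanUniqueness.lean`; ds-2's `RobustBall/StarDoorZd.lean`; ds-1's
`Thresholds/StarUniquenessZd.lean`, `StarTransferZd.lean`; ds-4's `StarWindowBoundLemmaG.lean`; the seat's `BoundaryDecayBall.lean`.
-/

noncomputable section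

open MeasureTheory ProbabilityTheory Function Finset Real
open scoped NNReal
open Literature.Probability.LatticeModels
open Literature.Probability.LatticeModels.DobrushinMetric (IsLipBound integrable_of_abs_le')
open Literature.MathematicalPhysics.QuantumLattice
open Literature.MathematicalPhysics.QuantumFieldTheory (suFrobDist suFrobDist_nonneg suFrobDist_le
  suFrobDist_self suEntries dist_suEntries_le_suFrobDist IsLipschitzCylinder isSpecification_ymSpecification_of_t2Space)
open Summit.Ventures.YMGap.DSWindowZd
open Summit.Ventures.YMGap.StarWindowGauge (gaugeR gaugeR_lt_one_of_le)
open Summit.Ventures.YMGap.StarLemmaG (starWindowBound_lemmaG gaugeR_nonneg)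

namespace Summit.Ventures.YMGap.RobustBall

variable {d N : ℕ}

/-! ### The depth profile of a finite volume -/

/-- **THE DEPTH PROFILE FOR THE STAR WINDOWS.** For a finite link volume `Λ₀`, a depth function `φ` (`φ x ≤ φ y + ‖x.1 − y.1‖_∞`,
`φ x > 0 ⇒ x ∈ Λ₀`) and locality sets `nbhd c` of radius `D ≥ 1` around the star centres, the profile `ℓ x = ⌊φ x/(D+2)⌋` has: every
star through a link of positive profile has its centre and its locality set inside `Λ₀`; `ℓ` drops by at most one from a link of a star
to a link of the star's locality set; `ℓ ≥ ⌊m/(D+2)⌋` wherever `φ ≥ m`. [folklore] -/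
theorem exists_starDepthProfile {D : ℕ} (hD : 1 ≤ D) {nbhd : ZdEdge d → Finset (ZdEdge d)}
    (hnbhd : ∀ (c : ZdEdge d), ∀ y ∈ nbhd c, ∀ i, (y.1 i - c.1 i).natAbs ≤ D)
    (K : Site d → ZdEdge d → ZdEdge d → ℝ) (hKsupp : ∀ (c : ZdEdge d) (y x : ZdEdge d), K c.1 y x ≠ 0 → y ∈ nbhd c)
    (Λ₀ Δ : Finset (ZdEdge d)) (φ : ZdEdge d → ℝ) (hφ : ∀ x y : ZdEdge d, φ x ≤ φ y + ‖x.1 - y.1‖)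
    (hφΛ : ∀ x, 0 < φ x → x ∈ Λ₀) {m : ℝ} (hm : ∀ x ∈ Δ, m ≤ φ x) :
    ∃ ℓ : ZdEdge d → ℕ,
      (∀ x, ℓ x ≠ 0 → ∀ c, x ∈ starWinZd c → c ∈ Λ₀ ∧ nbhd c ⊆ Λ₀) ∧
      (∀ c x y, x ∈ starWinZd c → K c.1 y x ≠ 0 → ℓ x ≤ ℓ y + 1) ∧
      (∀ x ∈ Δ, ⌊m / (D + 2 : ℕ)⌋₊ ≤ ℓ x) := by
  classical
  have hD2 : (0 : ℝ) < (D + 2 : ℕ) := by positivity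
  have hstar : ∀ {c x : ZdEdge d}, x ∈ starWinZd c → ‖c.1 - x.1‖ ≤ 1 := fun {c x} hxc => by
    have h := norm_le_of_natAbs_le (a := c.1 - x.1) (n := 1) fun i => by
      have h := natAbs_sub_le_one_of_mem_vertexStarZd hxc i
      rw [Pi.sub_apply, ← Int.natAbs_neg, neg_sub]
      exact h
    exact_mod_cast h
  have hfloor : ∀ a : ℝ, ⌊a + 1⌋₊ ≤ ⌊a⌋₊ + 1 := fun a => by
    rcases le_or_gt 0 a with ha | ha
    · rw [Nat.floor_add_one ha]
    · rw [Nat.floor_eq_zero.2 (by linarith : a + 1 < 1)]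
      exact Nat.zero_le _
  have hnb : ∀ {c y : ZdEdge d}, y ∈ nbhd c → ‖y.1 - c.1‖ ≤ D := fun {c y} hy => by
    refine norm_le_of_natAbs_le fun i => ?_
    rw [Pi.sub_apply]
    exact hnbhd c y hy i
  refine ⟨fun x => ⌊φ x / (D + 2 : ℕ)⌋₊, ?_, ?_, ?_⟩
  · intro x hx c hxc
    have hdepth : ((D + 2 : ℕ) : ℝ) ≤ φ x := by
      by_contra h
      exact hx (Nat.floor_eq_zero.2 ((div_lt_one hD2).2 (not_le.mp h)))
    have hD2' : ((D + 2 : ℕ) : ℝ) = D + 2 := by push_cast; ring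
    have hxc' : ‖x.1 - c.1‖ ≤ 1 := by rw [norm_sub_rev]; exact hstar hxc
    have hD0 : (1 : ℝ) ≤ D := by exact_mod_cast hD
    refine ⟨hφΛ c ?_, fun y hy => hφΛ y ?_⟩
    · have h1 := hφ x c
      linarith
    · have h1 := hφ x y
      have e2 : ‖c.1 - y.1‖ ≤ D := by rw [norm_sub_rev]; exact hnb hy
      have h2 : ‖x.1 - y.1‖ ≤ D + 1 := by
        calc ‖x.1 - y.1‖ = ‖(x.1 - c.1) + (c.1 - y.1)‖ := by congr 1; abel
          _ ≤ ‖x.1 - c.1‖ + ‖c.1 - y.1‖ := norm_add_le _ _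
          _ ≤ 1 + D := add_le_add hxc' e2
          _ = D + 1 := add_comm _ _
      linarith
  · intro c x y hxc hK
    have hy : y ∈ nbhd c := hKsupp _ _ _ hK
    have hyx : ‖x.1 - y.1‖ ≤ ((D + 1 : ℕ) : ℝ) := by
      refine norm_le_of_natAbs_le fun i => ?_
      have h1 := natAbs_sub_le_one_of_mem_vertexStarZd hxc i
      have h2 := hnbhd c y hy i
      simp only [Pi.sub_apply]
      omega
    have hD12 : ((D + 1 : ℕ) : ℝ) ≤ ((D + 2 : ℕ) : ℝ) := by exact_mod_cast Nat.le_succ _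
    have h1 : φ x / (D + 2 : ℕ) ≤ φ y / (D + 2 : ℕ) + 1 := by
      rw [div_add_one hD2.ne', div_le_div_iff_of_pos_right hD2]
      have h3 := hφ x y
      linarith
    calc ⌊φ x / (D + 2 : ℕ)⌋₊ ≤ ⌊φ y / (D + 2 : ℕ) + 1⌋₊ := Nat.floor_mono h1
      _ ≤ ⌊φ y / (D + 2 : ℕ)⌋₊ + 1 := hfloor _
  · intro x hx
    exact Nat.floor_mono (div_le_div_of_nonneg_right (hm x hx) hD2.le)

/-! ### Door level: two boundary fields, and every Gibbs measure -/

/-- ★★ **A FINITE VOLUME FORGETS ITS BOUNDARY FIELD THROUGH A `ℤ^d` STAR DOOR.** Let `γ` be a specification on the links of `ℤ^d` with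
`SU(N)` spins (`IsSpecification`) whose star kernels are quasilocal with locality sets `nbhd c ⊇ starWinZd c` of radius `D ≥ 1`, carrying a
star array `K ≥ 0` supported in the locality sets with the sitewise window contraction (H1) for the Frobenius weight and per-star received sum
`≤ ρ < 1`. Then for every finite link volume `Λ₀`, ANY TWO boundary fields `ω, η`, every depth function `φ` of `Λ₀` and every bounded
measurable `F` on links `Δ ⊆ Λ₀` (`φ ≥ m` on `Δ`) with Frobenius-Lipschitz vector `δ`:
`|∫F dγ_{Λ₀}(·|ω) − ∫F dγ_{Λ₀}(·|η)| ≤ 2(2√N) exp(−starRate d ρ · ⌊m/(D+2)⌋) Σ_{x ∈ Δ} δ x` (Literature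
`DobrushinShlosman.abs_integral_sub_integral_le_of_window` with the depth profile). [folklore] -/
theorem abs_kernel_sub_kernel_le_of_starArray {γ : Specification (ZdEdge d) (SUN N)} (hγ : IsSpecification γ)
    {D : ℕ} (hD : 1 ≤ D) {nbhd : ZdEdge d → Finset (ZdEdge d)} (hwin : ∀ c, starWinZd c ⊆ nbhd c)
    (hnbhd : ∀ (c : ZdEdge d), ∀ y ∈ nbhd c, ∀ i, (y.1 i - c.1 i).natAbs ≤ D)
    (hloc : ∀ (c : ZdEdge d) (ζ ζ' : LGConfig d (SUN N)), (∀ v ∈ nbhd c, ζ v = ζ' v) →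
      ∀ (f : LGConfig d (SUN N) → ℝ), Measurable f → (∃ B, ∀ σ, |f σ| ≤ B) →
        DependsOn f (starWinZd c : Set (ZdEdge d)) →
        ∫ σ, f σ ∂(γ (starWinZd c) ζ) = ∫ σ, f σ ∂(γ (starWinZd c) ζ'))
    {K : Site d → ZdEdge d → ZdEdge d → ℝ} (hK0 : ∀ s y x, 0 ≤ K s y x)
    (hKsupp : ∀ (c : ZdEdge d) (y x : ZdEdge d), K c.1 y x ≠ 0 → y ∈ nbhd c)
    (hcontract : ∀ (c y : ZdEdge d), y ∉ starWinZd c →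
      ∀ (ω η : LGConfig d (SUN N)), (∀ v, v ≠ y → ω v = η v) →
      ∀ (f : LGConfig d (SUN N) → ℝ) (δ : ZdEdge d → ℝ),
        Measurable f → (∃ B, ∀ σ, |f σ| ≤ B) → DependsOn f (starWinZd c : Set (ZdEdge d)) →
        (∀ x, 0 ≤ δ x) →
        (∀ (x : ZdEdge d) (σ τ : LGConfig d (SUN N)), (∀ v, v ≠ x → σ v = τ v) →
          |f σ - f τ| ≤ δ x * suFrobDist (σ x) (τ x)) →
          |∫ σ, f σ ∂(γ (starWinZd c) ω) - ∫ σ, f σ ∂(γ (starWinZd c) η)| ≤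
            (∑ x ∈ starWinZd c, K c.1 y x * δ x) * suFrobDist (ω y) (η y))
    {ρ : ℝ} (hρ0 : 0 ≤ ρ) (hρ1 : ρ < 1) (hsum : ∀ (c : ZdEdge d), ∀ x ∈ starWinZd c, ∑ y ∈ nbhd c, K c.1 y x ≤ ρ)
    (Λ₀ : Finset (ZdEdge d)) (ω η : LGConfig d (SUN N)) (φ : ZdEdge d → ℝ)
    (hφ : ∀ x y : ZdEdge d, φ x ≤ φ y + ‖x.1 - y.1‖) (hφΛ : ∀ x, 0 < φ x → x ∈ Λ₀)
    {F : LGConfig d (SUN N) → ℝ} (hFm : Measurable F) {B : ℝ} (hB : ∀ σ, |F σ| ≤ B) {Δ : Finset (ZdEdge d)}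
    (hFdep : DependsOn F (Δ : Set (ZdEdge d))) {δ : ZdEdge d → ℝ} (hδ : IsLipBound suFrobDist F δ)
    (hΔ : Δ ⊆ Λ₀) {m : ℝ} (hm : ∀ x ∈ Δ, m ≤ φ x) :
    |∫ σ, F σ ∂(γ Λ₀ ω) - ∫ σ, F σ ∂(γ Λ₀ η)| ≤
      2 * (2 * Real.sqrt N) * Real.exp (-(starRate d ρ * ⌊m / (D + 2 : ℕ)⌋₊)) * ∑ x ∈ Δ, δ x := by
  classical
  have hR₀ : (0 : ℝ) ≤ 2 * Real.sqrt N := by positivity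
  obtain ⟨ℓ, hU, hℓ, hL⟩ := exists_starDepthProfile hD hnbhd K hKsupp Λ₀ Δ φ hφ hφΛ hm
  have hFdepΛ : DependsOn F (Λ₀ : Set (ZdEdge d)) :=
    hFdep.mono fun v hv => Finset.mem_coe.2 (hΔ (Finset.mem_coe.1 hv))
  have hδL : ∀ x, ℓ x < ⌊m / (D + 2 : ℕ)⌋₊ → (fun x => if x ∈ Δ then δ x else 0) x = 0 := fun x hx => by
    dsimp only
    split_ifs with hxΔ
    · exact absurd (hL x hxΔ) (not_le.2 hx)
    · rfl
  have key := DobrushinShlosman.abs_integral_sub_integral_le_of_window hγ suFrobDist_nonneg suFrobDist_le hR₀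
    (win := starWinZd) (nbhd := nbhd) (K := fun c => K c.1) (fun c y x => hK0 _ _ _)
    self_mem_starWinZd hwin (fun c y x => hKsupp c y x) hcontract hloc hρ0 hρ1 (fun c x hx => hsum c x hx)
    (Nstar := 2 * d) card_filter_mem_starWinZd_le Λ₀ ω η ℓ _ hU hℓ hFm hB hFdepΛ (hδ.restrict hFdep) hδL
  have hs : ∑ x ∈ Λ₀, (if x ∈ Δ then δ x else 0) = ∑ x ∈ Δ, δ x := by
    rw [Finset.sum_ite_mem, Finset.inter_eq_right.2 hΔ]
  rw [hs] at key
  exact key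

/-- **Against every Gibbs measure** (DLR: `∫F dμ = ∫ γ_{Λ₀}(F|ω) dμ(ω)`): under the hypotheses of `abs_kernel_sub_kernel_le_of_starArray`,
for every Gibbs measure `μ` of `γ`, every finite `Λ₀`, EVERY boundary field `η`:
`|∫F dγ_{Λ₀}(·|η) − ∫F dμ| ≤ 2(2√N) exp(−starRate d ρ · ⌊m/(D+2)⌋) Σ_{Δ} δ`. [folklore] -/
theorem abs_kernel_sub_integral_le_of_starArray {γ : Specification (ZdEdge d) (SUN N)} (hγ : IsSpecification γ)
    {D : ℕ} (hD : 1 ≤ D) {nbhd : ZdEdge d → Finset (ZdEdge d)} (hwin : ∀ c, starWinZd c ⊆ nbhd c)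
    (hnbhd : ∀ (c : ZdEdge d), ∀ y ∈ nbhd c, ∀ i, (y.1 i - c.1 i).natAbs ≤ D)
    (hloc : ∀ (c : ZdEdge d) (ζ ζ' : LGConfig d (SUN N)), (∀ v ∈ nbhd c, ζ v = ζ' v) →
      ∀ (f : LGConfig d (SUN N) → ℝ), Measurable f → (∃ B, ∀ σ, |f σ| ≤ B) →
        DependsOn f (starWinZd c : Set (ZdEdge d)) →
        ∫ σ, f σ ∂(γ (starWinZd c) ζ) = ∫ σ, f σ ∂(γ (starWinZd c) ζ'))
    {K : Site d → ZdEdge d → ZdEdge d → ℝ} (hK0 : ∀ s y x, 0 ≤ K s y x)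
    (hKsupp : ∀ (c : ZdEdge d) (y x : ZdEdge d), K c.1 y x ≠ 0 → y ∈ nbhd c)
    (hcontract : ∀ (c y : ZdEdge d), y ∉ starWinZd c →
      ∀ (ω η : LGConfig d (SUN N)), (∀ v, v ≠ y → ω v = η v) →
      ∀ (f : LGConfig d (SUN N) → ℝ) (δ : ZdEdge d → ℝ),
        Measurable f → (∃ B, ∀ σ, |f σ| ≤ B) → DependsOn f (starWinZd c : Set (ZdEdge d)) →
        (∀ x, 0 ≤ δ x) →
        (∀ (x : ZdEdge d) (σ τ : LGConfig d (SUN N)), (∀ v, v ≠ x → σ v = τ v) →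
          |f σ - f τ| ≤ δ x * suFrobDist (σ x) (τ x)) →
          |∫ σ, f σ ∂(γ (starWinZd c) ω) - ∫ σ, f σ ∂(γ (starWinZd c) η)| ≤
            (∑ x ∈ starWinZd c, K c.1 y x * δ x) * suFrobDist (ω y) (η y))
    {ρ : ℝ} (hρ0 : 0 ≤ ρ) (hρ1 : ρ < 1) (hsum : ∀ (c : ZdEdge d), ∀ x ∈ starWinZd c, ∑ y ∈ nbhd c, K c.1 y x ≤ ρ)
    {μ : Measure (LGConfig d (SUN N))} (hμ : IsGibbsMeasure γ μ)
    (Λ₀ : Finset (ZdEdge d)) (η : LGConfig d (SUN N)) (φ : ZdEdge d → ℝ)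
    (hφ : ∀ x y : ZdEdge d, φ x ≤ φ y + ‖x.1 - y.1‖) (hφΛ : ∀ x, 0 < φ x → x ∈ Λ₀)
    {F : LGConfig d (SUN N) → ℝ} (hFm : Measurable F) {B : ℝ} (hB : ∀ σ, |F σ| ≤ B) {Δ : Finset (ZdEdge d)}
    (hFdep : DependsOn F (Δ : Set (ZdEdge d))) {δ : ZdEdge d → ℝ} (hδ : IsLipBound suFrobDist F δ)
    (hΔ : Δ ⊆ Λ₀) {m : ℝ} (hm : ∀ x ∈ Δ, m ≤ φ x) :
    |(∫ σ, F σ ∂(γ Λ₀ η)) - ∫ σ, F σ ∂μ| ≤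
      2 * (2 * Real.sqrt N) * Real.exp (-(starRate d ρ * ⌊m / (D + 2 : ℕ)⌋₊)) * ∑ x ∈ Δ, δ x := by
  haveI := hμ.isProbabilityMeasure
  set C : ℝ := 2 * (2 * Real.sqrt N) * Real.exp (-(starRate d ρ * ⌊m / (D + 2 : ℕ)⌋₊)) * ∑ x ∈ Δ, δ x with hC
  have hpt : ∀ ω, |(∫ σ, F σ ∂(γ Λ₀ η)) - ∫ σ, F σ ∂(γ Λ₀ ω)| ≤ C := fun ω =>
    abs_kernel_sub_kernel_le_of_starArray hγ hD hwin hnbhd hloc hK0 hKsupp hcontract hρ0 hρ1 hsum Λ₀ η ω φ hφ hφΛ hFm hB hFdep hδ hΔ hm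
  have hgm : Measurable fun ω => ∫ σ, F σ ∂(γ Λ₀ ω) := DobrushinShlosman.measurable_windowAvg' hγ Λ₀ hFm
  have hgB : ∀ ω, |∫ σ, F σ ∂(γ Λ₀ ω)| ≤ B := fun ω => DobrushinShlosman.abs_windowAvg_le' hγ Λ₀ hB ω
  have hgi : Integrable (fun ω => ∫ σ, F σ ∂(γ Λ₀ ω)) μ := integrable_of_abs_le' hgm hgB
  have hDLR : ∫ σ, F σ ∂μ = ∫ ω, ∫ σ, F σ ∂(γ Λ₀ ω) ∂μ :=
    (hμ.integral_integral_eq hγ Λ₀ (integrable_of_abs_le' hFm hB)).symm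
  rw [hDLR]
  have h1 : (∫ σ, F σ ∂(γ Λ₀ η)) - ∫ ω, ∫ σ, F σ ∂(γ Λ₀ ω) ∂μ =
      ∫ ω, ((∫ σ, F σ ∂(γ Λ₀ η)) - ∫ σ, F σ ∂(γ Λ₀ ω)) ∂μ := by
    rw [integral_sub (integrable_const _) hgi, integral_const, smul_eq_mul, probReal_univ, one_mul]
  rw [h1]
  calc |∫ ω, ((∫ σ, F σ ∂(γ Λ₀ η)) - ∫ σ, F σ ∂(γ Λ₀ ω)) ∂μ|
      ≤ ∫ ω, |(∫ σ, F σ ∂(γ Λ₀ η)) - ∫ σ, F σ ∂(γ Λ₀ ω)| ∂μ := abs_integral_le_integral_abs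
    _ ≤ ∫ _ω, C ∂μ := integral_mono_of_nonneg (ae_of_all _ fun ω => abs_nonneg _) (integrable_const C)
        (ae_of_all _ hpt)
    _ = C := by simp

/-- **Through ds-1's Wilson star door `StarWindowBoundZd d N β ρ suFrobDist`** (Wilson action at bare coupling `β`, locality sets `starNbhdZd`
of radius `2`, quasilocality by `dependsOn_integral_ymSpecification`): for every Gibbs measure `μ`, every finite `Λ₀`, EVERY boundary field `η`,
every depth function `φ` of `Λ₀`: `|∫F dγ_{Λ₀}(·|η) − ∫F dμ| ≤ 2(2√N) exp(−starRate d ρ · ⌊m/4⌋) Σ_{Δ} δ`. [folklore] -/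
theorem abs_kernel_sub_integral_le_of_starWindowBoundZd {β ρ : ℝ} (hρ0 : 0 ≤ ρ) (hρ1 : ρ < 1)
    (h : StarWindowBoundZd d N β ρ suFrobDist)
    {μ : Measure (LGConfig d (SUN N))} (hμ : IsGibbsMeasure (ymSpecification (d := d) (fundamentalRep (Fin N)) β) μ)
    (Λ₀ : Finset (ZdEdge d)) (η : LGConfig d (SUN N)) (φ : ZdEdge d → ℝ)
    (hφ : ∀ x y : ZdEdge d, φ x ≤ φ y + ‖x.1 - y.1‖) (hφΛ : ∀ x, 0 < φ x → x ∈ Λ₀)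
    {F : LGConfig d (SUN N) → ℝ} (hFm : Measurable F) {B : ℝ} (hB : ∀ σ, |F σ| ≤ B) {Δ : Finset (ZdEdge d)}
    (hFdep : DependsOn F (Δ : Set (ZdEdge d))) {δ : ZdEdge d → ℝ} (hδ : IsLipBound suFrobDist F δ)
    (hΔ : Δ ⊆ Λ₀) {m : ℝ} (hm : ∀ x ∈ Δ, m ≤ φ x) :
    |(∫ σ, F σ ∂(ymSpecification (d := d) (fundamentalRep (Fin N)) β Λ₀ η)) - ∫ σ, F σ ∂μ| ≤
      2 * (2 * Real.sqrt N) * Real.exp (-(starRate d ρ * ⌊m / (2 + 2 : ℕ)⌋₊)) * ∑ x ∈ Δ, δ x := by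
  classical
  haveI : SecondCountableTopology (Matrix (Fin N) (Fin N) ℂ) :=
    inferInstanceAs (SecondCountableTopology (Fin N → Fin N → ℂ))
  haveI : SecondCountableTopology (SUN N) := Topology.IsEmbedding.subtypeVal.secondCountableTopology
  have hγ : IsSpecification (ymSpecification (d := d) (fundamentalRep (Fin N)) β) :=
    isSpecification_ymSpecification_of_t2Space _ (continuous_fundamentalRep (Fin N)) _
  obtain ⟨K, hK0, hKsupp, hcontract, hsum⟩ := h
  have hloc : ∀ (c : ZdEdge d) (ζ ζ' : LGConfig d (SUN N)), (∀ v ∈ starNbhdZd c.1, ζ v = ζ' v) →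
      ∀ (f : LGConfig d (SUN N) → ℝ), Measurable f → (∃ B, ∀ σ, |f σ| ≤ B) →
        DependsOn f (starWinZd c : Set (ZdEdge d)) →
        ∫ σ, f σ ∂(ymSpecification (d := d) (fundamentalRep (Fin N)) β (starWinZd c) ζ) =
          ∫ σ, f σ ∂(ymSpecification (d := d) (fundamentalRep (Fin N)) β (starWinZd c) ζ') := by
    intro c ζ ζ' hζ f hfm' _ hfdep'
    exact dependsOn_integral_ymSpecification (fundamentalRep (Fin N)) (continuous_fundamentalRep (Fin N))
      β (starWinZd c) hfm' hfdep' fun v hv => hζ v (Finset.mem_coe.1 hv)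
  exact abs_kernel_sub_integral_le_of_starArray hγ (D := 2) (by norm_num) (nbhd := fun c => starNbhdZd c.1)
    (fun c => vertexStarZd_subset_starNbhdZd c.1) (fun c y hy i => natAbs_sub_le_two_of_mem_starNbhdZd hy i) hloc hK0
    (fun c y x h' => hKsupp _ _ _ h') hcontract hρ0 hρ1 (fun c x hx => hsum c.1 x hx) hμ Λ₀ η φ hφ hφΛ hFm hB hFdep hδ hΔ hm

/-! ### `SU(2)` lattice Yang–Mills on `ℤ⁴` at every `0 ≤ β_W ≤ 9/25`, hypothesis-free -/

/-- ★★★ **`SU(2)`, `d = 4`, WILSON ACTION, EVERY `0 ≤ β_W ≤ 9/25`: A FINITE VOLUME FORGETS ITS BOUNDARY FIELD AT THE STAR RATE,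
HYPOTHESIS-FREE** (tree bare coupling `β_W/2`). For every finite link volume `Λ₀`, EVERY boundary field `η`, EVERY DLR state `μ`, every depth
function `φ` of `Λ₀` (`1`-Lipschitz in the sup-norm of base points, `φ > 0 ⇒ ∈ Λ₀`) and every Lipschitz cylinder `F` (constant `K`, links `Δ ⊆ Λ₀`
with `φ ≥ m` on `Δ`): `|∫F dγ_{Λ₀}(·|η) − ∫F dμ| ≤ 4√2 · K · #Δ · exp(−starRate 4 (R_G β_W) · ⌊m/4⌋)` — Lemma G on the torus of side `5`,
the torus → `ℤ⁴` transfer and the star boundary door above; compare `su2_wilson_boundary_upTo_oneTwelfth` (`β_W ≤ 1/12`) and the KR door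
(`β_W ≤ 2/9`). [folklore] -/
theorem su2_wilson_boundary_star {βW : ℝ} (h0 : 0 ≤ βW) (h : βW ≤ 9 / 25)
    {μ : Measure (LGConfig 4 (SUN 2))} (hμ : μ ∈ ymGibbsMeasures (d := 4) (fundamentalRep (Fin 2)) (βW / 2))
    (Λ₀ : Finset (ZdEdge 4)) (η : LGConfig 4 (SUN 2)) (φ : ZdEdge 4 → ℝ)
    (hφ : ∀ x y : ZdEdge 4, φ x ≤ φ y + ‖x.1 - y.1‖) (hφΛ : ∀ x, 0 < φ x → x ∈ Λ₀)
    {F : LGConfig 4 (SUN 2) → ℝ} {Δ : Finset (ZdEdge 4)} {K : ℝ≥0}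
    (hF : IsLipschitzCylinder (fundamentalRep (Fin 2)) F Δ K) (hΔ : Δ ⊆ Λ₀) {m : ℝ} (hm : ∀ x ∈ Δ, m ≤ φ x) :
    |(∫ U, F U ∂(ymSpecification (d := 4) (fundamentalRep (Fin 2)) (βW / 2) Λ₀ η)) - ∫ U, F U ∂μ| ≤
      4 * Real.sqrt 2 * K * Δ.card * Real.exp (-(starRate 4 (gaugeR βW) * ⌊m / (4 : ℕ)⌋₊)) := by
  have hρ0 : 0 ≤ gaugeR βW := gaugeR_nonneg h0 (by linarith)
  have hρ1 : gaugeR βW < 1 := gaugeR_lt_one_of_le h0 h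
  have hZd : StarWindowBoundZd 4 2 (βW / 2) (gaugeR βW) suFrobDist :=
    starWindowBoundZd_of_starWindowBound (L := 5) le_rfl suFrobDist_nonneg (starWindowBound_lemmaG (by norm_num) h0 (by linarith))
  have hA : ∀ a b : SUN 2, dist (suEntries a) (suEntries b) ≤ 1 * suFrobDist a b := fun a b => by
    rw [one_mul]; exact dist_suEntries_le_suFrobDist a b
  have hμ' : IsGibbsMeasure (ymSpecification (d := 4) (fundamentalRep (Fin 2)) (βW / 2)) μ := hμ
  have key := abs_kernel_sub_integral_le_of_starWindowBoundZd (d := 4) (N := 2) hρ0 hρ1 hZd hμ' Λ₀ η φ hφ hφΛ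
    hF.measurable hF.abs_le hF.dependsOn (hF.isLipBound zero_le_one hA) hΔ hm
  have hK : (0 : ℝ) ≤ K := K.2
  have hsum : ∑ y ∈ Δ, (if y ∈ Δ then 1 * (K : ℝ) else 0) = Δ.card * K := by
    rw [Finset.sum_ite_of_true (fun y hy => hy), Finset.sum_const, nsmul_eq_mul, one_mul]
  have hsq : Real.sqrt ((2 : ℕ) : ℝ) = Real.sqrt 2 := by norm_num
  have h22 : (2 + 2 : ℕ) = 4 := by norm_num
  rw [hsum, hsq, h22] at key
  calc |(∫ U, F U ∂(ymSpecification (d := 4) (fundamentalRep (Fin 2)) (βW / 2) Λ₀ η)) - ∫ U, F U ∂μ|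
      ≤ 2 * (2 * Real.sqrt 2) * Real.exp (-(starRate 4 (gaugeR βW) * ⌊m / (4 : ℕ)⌋₊)) * (Δ.card * K) := key
    _ = 4 * Real.sqrt 2 * K * Δ.card * Real.exp (-(starRate 4 (gaugeR βW) * ⌊m / (4 : ℕ)⌋₊)) := by ring

/-- **Boxes, `SU(2)`, `d = 4`, `0 ≤ β_W ≤ 9/25`**: for the volume `Λ₀ =` links based in `box 4 M`, EVERY boundary field `η` on it, EVERY DLR state `μ`
and a Lipschitz cylinder `F` on links based in `box 4 M'`, `M' ≤ M`:
`|∫F dγ_{box M}(·|η) − ∫F dμ| ≤ 4√2 · K · #Δ · exp(−starRate 4 (R_G β_W) · ⌊(M + 1 − M')/4⌋)` — the thermodynamic limit along boxes at the star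
rate, UNIFORMLY IN THE BOUNDARY FIELD, on the whole vertex-star window (depth function `M + 1 − ‖x.1‖_∞`). [folklore] -/
theorem su2_wilson_box_star {βW : ℝ} (h0 : 0 ≤ βW) (h : βW ≤ 9 / 25) {M M' : ℕ} (hMM : M' ≤ M)
    {μ : Measure (LGConfig 4 (SUN 2))} (hμ : μ ∈ ymGibbsMeasures (d := 4) (fundamentalRep (Fin 2)) (βW / 2))
    (η : LGConfig 4 (SUN 2)) {F : LGConfig 4 (SUN 2) → ℝ} {Δ : Finset (ZdEdge 4)} {K : ℝ≥0}
    (hF : IsLipschitzCylinder (fundamentalRep (Fin 2)) F Δ K) (hΔ : Δ ⊆ (box 4 M') ×ˢ (Finset.univ : Finset (Fin 4))) :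
    |(∫ U, F U ∂(ymSpecification (d := 4) (fundamentalRep (Fin 2)) (βW / 2)
        ((box 4 M) ×ˢ (Finset.univ : Finset (Fin 4))) η)) - ∫ U, F U ∂μ| ≤
      4 * Real.sqrt 2 * K * Δ.card * Real.exp (-(starRate 4 (gaugeR βW) * ⌊((M : ℝ) + 1 - M') / (4 : ℕ)⌋₊)) := by
  classical
  have hΔ' : Δ ⊆ (box 4 M) ×ˢ (Finset.univ : Finset (Fin 4)) := fun x hx => by
    have h1 := Finset.mem_product.1 (hΔ hx)
    refine Finset.mem_product.2 ⟨mem_box.2 fun i => ?_, Finset.mem_univ _⟩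
    have := (mem_box.1 h1.1) i
    omega
  refine su2_wilson_boundary_star h0 h hμ _ η (fun x => (M : ℝ) + 1 - supNormZd x.1)
    (fun x y => ?_) (fun x hx => ?_) hF hΔ' (fun x hx => ?_)
  · have h1 := supNormZd_le_supNormZd_add_norm y.1 x.1
    rw [norm_sub_rev] at h1
    linarith
  · refine Finset.mem_product.2 ⟨mem_box.2 fun i => ?_, Finset.mem_univ _⟩
    have h1 : (supNormZd x.1 : ℝ) < M + 1 := by linarith
    have h1' : supNormZd x.1 < M + 1 := by exact_mod_cast h1
    have h2 : supNormZd x.1 ≤ M := Nat.lt_succ_iff.1 h1'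
    have h3 := natAbs_le_supNormZd x.1 i
    omega
  · have h1 := Finset.mem_product.1 (hΔ hx)
    have h2 : supNormZd x.1 ≤ M' := supNormZd_le_iff.2 fun i => by
      have := (mem_box.1 h1.1) i
      omega
    have h3 : (supNormZd x.1 : ℝ) ≤ M' := by exact_mod_cast h2
    linarith

end Summit.Ventures.YMGap.RobustBall

end
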